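import Literature.Probability.LatticeModels.PlanarIsingMultiPointLimits
import Literature.Probability.LatticeModels.PlanarIsingCovarianceTransport
import HarnessLib

/-!
# CHI Theorem 1.3 for all `k`, II: covariance (1.2) and the assembly of `chi_multiPoint_rho`

Continuation of `PlanarIsingMultiPointLimits.lean` (CHI = Chelkak–Hongler–Izyurov, Ann. of Math.
181 (2015) = arXiv:1202.2838, arXiv numbering). The induction of CHI §2.10 (p. 20) is run
simultaneously in two admissible domains `Ω, Ω'` whose discretisations approximate them, related
by a conformal bijection `φ : Ω → Ω'`, with the auxiliary point `c` near `∂Ω` chosen so that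
`φ(c)` is near `∂Ω'` (`exists_infDist_lt_imp_infDist_image_lt`: continuity of `φ⁻¹`,
`Complex.hasStrictDerivAt_invFunOn`). The pinchings `ℓ ≤ G ≤ (1-η)⁻¹ℓ` in `Ω` and
`ℓ' ≤ G' ≤ (1-η)⁻¹ℓ'` in `Ω'`, together with `ℓ' = ∏ |φ'|^{-1/8} ℓ` — which is CHI Remark 2.21,
eq. (2.22) (covariance of the *ratios*, hypothesis predicate `CHIRatioCovariance`), the covariance
of the one-point limits (`CHIOnePointCovariance`, a consequence of `chi_onePoint_rho`) and the
induction hypothesis — give `G' = ∏ᵢ |φ'(aᵢ)|^{-1/8} G` as `η → 0` (`limit_covariance_of_CHI`).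

Assembly (`chi_multiPoint_rho_of_CHI`): from the named fact `chi_onePoint_rho` (CHI Thm 1.3,
`k = 0`; reduced to CHI Thm 1.1, Prop 2.20 (`k = 0`), Lemma 2.26 (`k = 1`) in
`PlanarIsingOnePointProofs.lean`) and the hypothesis predicates for CHI Prop 2.20, Lemma 2.26 and
Remark 2.21 on all approximable admissible domains, the limits exist
(`exists_pos_tendsto_rhoNormCorr`) and obey (1.2) between approximable admissible domains, which
is `chi_multiPoint_rho` by the Riemann-map transport `chi_multiPoint_rho_iff`
(`PlanarIsingCovarianceTransport.lean`). This is CHI's printed derivation of Theorem 1.3 from its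
§2 ingredients; the ingredients are binders, not named facts, and `chi_multiPoint_rho` is **not**
discharged here.

## References

* D. Chelkak, C. Hongler, K. Izyurov, Ann. of Math. (2) 181 (2015), 1087–1138; arXiv:1202.2838:
  Thm 1.3 with eq. (1.2), Prop 2.20, Remark 2.21 (eq. (2.22)), Lemma 2.26, §2.10.
* J. B. Conway, *Functions of one complex variable I*, 2nd ed., Thm. VII.4.2 (Riemann mapping
  theorem), as proved in `Literature.Analysis.Complex.RiemannMapping`.
-/

noncomputable section

open MeasureTheory Filter Topology Real Metric Set
open Literature.Probability.LatticeModels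

namespace Literature.Probability.LatticeModels

/-! ### The induction of CHI §2.10 for the covariance rule (1.2) -/

section Covariance

/-- Two-sided pinching for all small `η` forces equality: if
`(1 - η) P ≤ Q ≤ (1 - η)⁻¹ P` for every `η ∈ (0, 1/2]`, then `Q = P`. [folklore] -/
theorem eq_of_forall_pinch {P Q : ℝ}
    (h : ∀ η : ℝ, 0 < η → η ≤ 1 / 2 → (1 - η) * P ≤ Q ∧ Q ≤ (1 - η)⁻¹ * P) : Q = P := by
  have hev : ∀ᶠ η in 𝓝[>] (0 : ℝ), 0 < η ∧ η ≤ 1 / 2 := by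
    filter_upwards [Ioc_mem_nhdsGT (show (0 : ℝ) < 1 / 2 by norm_num)] with η hη
    exact ⟨hη.1, hη.2⟩
  have h1 : Tendsto (fun η : ℝ => (1 - η) * P) (𝓝[>] 0) (𝓝 P) := by
    have : Tendsto (fun η : ℝ => (1 - η) * P) (𝓝 0) (𝓝 ((1 - 0) * P)) :=
      (tendsto_const_nhds.sub tendsto_id).mul tendsto_const_nhds
    rw [sub_zero, one_mul] at this
    exact tendsto_nhdsWithin_of_tendsto_nhds this
  have h2 : Tendsto (fun η : ℝ => (1 - η)⁻¹ * P) (𝓝[>] 0) (𝓝 P) := by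
    have : Tendsto (fun η : ℝ => (1 - η)⁻¹ * P) (𝓝 0) (𝓝 ((1 - 0)⁻¹ * P)) :=
      ((tendsto_const_nhds.sub tendsto_id).inv₀ (by norm_num)).mul tendsto_const_nhds
    rw [sub_zero, inv_one, one_mul] at this
    exact tendsto_nhdsWithin_of_tendsto_nhds this
  exact le_antisymm (ge_of_tendsto h2 (hev.mono fun η hη => (h η hη.1 hη.2).2))
    (le_of_tendsto h1 (hev.mono fun η hη => (h η hη.1 hη.2).1))

/-- **Points close to `∂Ω` are mapped close to `∂Ω'`** by a conformal bijection `φ : Ω → Ω'` of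
admissible domains: for `ε' > 0` there is `ε₁ > 0` such that `infDist c Ωᶜ < ε₁` implies
`infDist (φ c) Ω'ᶜ < ε'` (`c ∈ Ω`). The points of `Ω'` at distance `≥ ε'` from `Ω'ᶜ` form a
compact subset of `Ω'`, whose image under the continuous inverse `φ⁻¹`
(`Complex.hasStrictDerivAt_invFunOn`, with `φ' ≠ 0` by injectivity) is a compact subset of `Ω`,
hence at positive distance from `Ωᶜ`. (CHI, proof of Lemma 2.26: "put `a` deeply inside …";
used in the covariance induction to place the auxiliary point near both boundaries.) [folklore] -/
theorem exists_infDist_lt_imp_infDist_image_lt {Ω Ω' : Set ℂ} (hΩ : IsAdmissibleDomain Ω)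
    (hΩ' : IsAdmissibleDomain Ω') {φ : ℂ → ℂ} (hφ : IsConformalBijection φ Ω Ω') {ε' : ℝ}
    (hε' : 0 < ε') :
    ∃ ε₁ : ℝ, 0 < ε₁ ∧ ∀ c ∈ Ω, Metric.infDist c Ωᶜ < ε₁ → Metric.infDist (φ c) Ω'ᶜ < ε' := by
  have hopen : IsOpen Ω := hΩ.1
  set g := Function.invFunOn φ Ω with hg
  have hinv : InvOn g φ Ω Ω' := hφ.2.invOn_invFunOn
  have hbijg : BijOn g Ω' Ω := hφ.2.symm hinv.symm
  have hder : ∀ z ∈ Ω, deriv φ z ≠ 0 := fun z hz =>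
    Literature.Analysis.Complex.SCV.deriv_ne_zero_of_injOn hφ.1 hopen hφ.2.injOn hz
  have hgc : ContinuousOn g Ω' := by
    intro w hw
    obtain ⟨z, hz, rfl⟩ := hφ.2.surjOn hw
    exact (Complex.hasStrictDerivAt_invFunOn hopen hφ.1 hφ.2.injOn hder hz).hasDerivAt
      |>.continuousAt.continuousWithinAt
  -- the compact `K' ⊆ Ω'` of points at distance `≥ ε'` from `Ω'ᶜ`, and `K = g '' K' ⊆ Ω`
  set K' : Set ℂ := {w | ε' ≤ Metric.infDist w Ω'ᶜ} with hK'
  have hK'Ω : K' ⊆ Ω' := by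
    intro w hw
    by_contra hwΩ
    have h0 : Metric.infDist w Ω'ᶜ = 0 := Metric.infDist_zero_of_mem hwΩ
    have hw' : ε' ≤ Metric.infDist w Ω'ᶜ := hw
    rw [h0] at hw'
    exact absurd hw' (not_le.2 hε')
  have hK'c : IsCompact K' := Metric.isCompact_of_isClosed_isBounded
    (isClosed_le continuous_const (Metric.continuous_infDist_pt _)) (hΩ'.2.1.subset hK'Ω)
  have hKc : IsCompact (g '' K') := hK'c.image_of_continuousOn (hgc.mono hK'Ω)
  have hKΩ : g '' K' ⊆ Ω := fun z ⟨w, hw, hwz⟩ => hwz ▸ hbijg.mapsTo (hK'Ω hw)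
  -- conclusion from: `c ∉ g '' K'` forces `φ c ∉ K'`
  have key : ∀ c ∈ Ω, c ∉ g '' K' → Metric.infDist (φ c) Ω'ᶜ < ε' := by
    intro c hc hcK
    by_contra hcon
    exact hcK ⟨φ c, not_lt.1 hcon, hinv.1 hc⟩
  rcases (g '' K').eq_empty_or_nonempty with hKe | hKne
  · exact ⟨1, one_pos, fun c hc _ => key c hc (by rw [hKe]; exact fun h => h)⟩
  · -- the positive minimum of `infDist · Ωᶜ` on the compact `g '' K' ⊆ Ω`
    obtain ⟨z₀, hz₀K, hmin⟩ :=
      hKc.exists_isMinOn hKne (Metric.continuous_infDist_pt _).continuousOn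
    have hΩc : (Ωᶜ).Nonempty := by
      by_contra h
      rw [Set.not_nonempty_iff_eq_empty, Set.compl_empty_iff] at h
      exact NormedSpace.unbounded_univ ℂ ℂ (h ▸ hΩ.2.1)
    have hpos : 0 < Metric.infDist z₀ Ωᶜ :=
      (hopen.isClosed_compl.notMem_iff_infDist_pos hΩc).1 (fun h => h (hKΩ hz₀K))
    refine ⟨Metric.infDist z₀ Ωᶜ, hpos, fun c hc hlt => key c hc fun hcK => ?_⟩
    exact absurd (hmin hcK) (not_le.2 hlt)

/-- **Hypothesis predicate — covariance of the one-point limits under `φ : Ω → Ω'`** (`T₀` with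
(1.2): `⟨σ_{φ a}⟩⁺_{Ω'} = |φ'(a)|^{-1/8} ⟨σ_a⟩⁺_Ω`), in limit form: whenever the normalised
magnetisations at `a` in `Ω` and at `φ(a)` in `Ω'` converge, the limits are so related. A
consequence of the named fact `chi_onePoint_rho` (explicit limits and the chain rule for
`φ̃ ∘ φ`, `φ̃ : Ω' → ℍ`). [cite: ChelkakHonglerIzyurovAnnals2015, Thm. 1.3 (k = 0) with eq. (1.2)] -/
def CHIOnePointCovariance (Ω Ω' : Set ℂ) (φ : ℂ → ℂ) : Prop :=
  ∀ a ∈ Ω, ∀ G G' : ℝ,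
    Tendsto (fun δ => rhoCHI δ ^ (-(1 : ℝ) / 2) * meshIsingPlusCorr Ω δ ![a]) (𝓝[>] 0) (𝓝 G) →
    Tendsto (fun δ => rhoCHI δ ^ (-(1 : ℝ) / 2) * meshIsingPlusCorr Ω' δ ![φ a]) (𝓝[>] 0)
      (𝓝 G') → G' = ‖deriv φ a‖ ^ (-(1 / 8 : ℝ)) * G

/-- **Hypothesis predicate — CHI Remark 2.21, eq. (2.22), under `φ : Ω → Ω'`** (the covariance
rule for the *ratios* of correlations, "a weaker form of (1.2)", obtained by integrating the
covariance (1.6) of `𝒜_Ω`):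
`⟨σ_b⟩⁺_Ω / ⟨σ_a⟩⁺_Ω = ⟨σ_{φb}⟩⁺_{Ω'} / ⟨σ_{φa}⟩⁺_{Ω'} · ∏ⱼ |φ'(bⱼ)|^{1/8} / |φ'(aⱼ)|^{1/8}`, in limit
form for the discrete ratios of Prop 2.20. Used below only as a binder.
[cite: ChelkakHonglerIzyurovAnnals2015, Remark 2.21, eq. (2.22)] -/
def CHIRatioCovariance (Ω Ω' : Set ℂ) (φ : ℂ → ℂ) : Prop :=
  ∀ (n : ℕ) (a b : Fin (n + 1) → ℂ), Function.Injective a → Function.Injective b →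
    (∀ i, a i ∈ Ω) → (∀ i, b i ∈ Ω) → ∀ r r' : ℝ,
      Tendsto (fun δ => meshIsingPlusCorr Ω δ b / meshIsingPlusCorr Ω δ a) (𝓝[>] 0) (𝓝 r) →
      Tendsto (fun δ => meshIsingPlusCorr Ω' δ (fun i => φ (b i)) /
          meshIsingPlusCorr Ω' δ (fun i => φ (a i))) (𝓝[>] 0) (𝓝 r') →
        r' = r * ((∏ i, ‖deriv φ (a i)‖ ^ (1 / 8 : ℝ)) / ∏ i, ‖deriv φ (b i)‖ ^ (1 / 8 : ℝ))

/-- Images of a tuple with a distinguished first point. [folklore] -/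
theorem comp_vecCons {n : ℕ} (φ : ℂ → ℂ) (c : ℂ) (A : Fin n → ℂ) :
    (fun i => φ (Matrix.vecCons c A i)) = Matrix.vecCons (φ c) fun i => φ (A i) := by
  funext i
  refine Fin.cases ?_ (fun j => ?_) i <;> simp

variable {Ω Ω' : Set ℂ} {φ : ℂ → ℂ}

/-- **The induction step of CHI's proof of Theorem 1.3 for the covariance rule (1.2)**: with the
pinching of p. 20 run in `Ω` at an auxiliary point `c` near `∂Ω` and in `Ω'` at `φ(c)` (near
`∂Ω'`, `exists_infDist_lt_imp_infDist_image_lt`), the limits `G = lim ϱ^{-(k+1)/2}𝔼⁺_Ω[σ_aσ_A]`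
and `G'` (images in `Ω'`) satisfy `ℓ ≤ G ≤ (1-η)⁻¹ℓ`, `ℓ' ≤ G' ≤ (1-η)⁻¹ℓ'`, where by Remark 2.21,
the one-point covariance and the induction hypothesis `ℓ' = ∏ |φ'|^{-1/8} · ℓ`; letting `η → 0`
gives `G' = ∏ |φ'|^{-1/8} · G`. [cite: ChelkakHonglerIzyurovAnnals2015, §2.10, proof of Thm. 1.3, with Remark 2.21] -/
theorem limit_covariance_cons (hΩ : IsAdmissibleDomain Ω) (hM : MeshApproximates Ω)
    (hΩ' : IsAdmissibleDomain Ω') (hM' : MeshApproximates Ω') (hφ : IsConformalBijection φ Ω Ω')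
    (h₁ : CHIOnePointLimits Ω) (hP : CHIRatioLimits Ω) (hL : CHIBoundaryDecorrelation Ω)
    (h₁' : CHIOnePointLimits Ω') (hP' : CHIRatioLimits Ω') (hL' : CHIBoundaryDecorrelation Ω')
    (h₁c : CHIOnePointCovariance Ω Ω' φ) (hR : CHIRatioCovariance Ω Ω' φ)
    {n : ℕ} {A : Fin (n + 1) → ℂ} (hA : Function.Injective A) (hAΩ : ∀ i, A i ∈ Ω)
    (hIH : ∀ GA GA' : ℝ, Tendsto (fun δ => rhoNormCorr Ω δ A) (𝓝[>] 0) (𝓝 GA) →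
      Tendsto (fun δ => rhoNormCorr Ω' δ (fun i => φ (A i))) (𝓝[>] 0) (𝓝 GA') →
        GA' = (∏ i, ‖deriv φ (A i)‖ ^ (-(1 / 8 : ℝ))) * GA)
    {a : ℂ} (ha : a ∈ Ω) (haA : ∀ i, a ≠ A i) {G G' : ℝ}
    (hG : Tendsto (fun δ => rhoNormCorr Ω δ (Matrix.vecCons a A)) (𝓝[>] 0) (𝓝 G))
    (hG' : Tendsto (fun δ => rhoNormCorr Ω' δ (Matrix.vecCons (φ a) fun i => φ (A i))) (𝓝[>] 0)
      (𝓝 G')) :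
    G' = (‖deriv φ a‖ ^ (-(1 / 8 : ℝ)) * ∏ i, ‖deriv φ (A i)‖ ^ (-(1 / 8 : ℝ))) * G := by
  have hopen : IsOpen Ω := hΩ.1
  have hder : ∀ z ∈ Ω, deriv φ z ≠ 0 := fun z hz =>
    Literature.Analysis.Complex.SCV.deriv_ne_zero_of_injOn hφ.1 hopen hφ.2.injOn hz
  -- the image data
  set A' : Fin (n + 1) → ℂ := fun i => φ (A i) with hA'_def
  have hA' : Function.Injective A' := fun i j h => hA (hφ.2.injOn (hAΩ i) (hAΩ j) h)
  have hA'Ω : ∀ i, A' i ∈ Ω' := fun i => hφ.2.mapsTo (hAΩ i)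
  have ha' : φ a ∈ Ω' := hφ.2.mapsTo ha
  have haA' : ∀ i, φ a ≠ A' i := fun i h => haA i (hφ.2.injOn ha (hAΩ i) h)
  -- lower-order limits in both domains, related by the induction hypothesis
  obtain ⟨GA, hGA, hXA⟩ := exists_pos_tendsto_rhoNormCorr hΩ hM h₁ hP hL (n + 1) A hA hAΩ
  obtain ⟨GA', hGA', hXA'⟩ := exists_pos_tendsto_rhoNormCorr hΩ' hM' h₁' hP' hL' (n + 1) A' hA' hA'Ω
  have hIHA : GA' = (∏ i, ‖deriv φ (A i)‖ ^ (-(1 / 8 : ℝ))) * GA := hIH GA GA' hXA hXA'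
  -- positivity of the covariance factors
  set qa : ℝ := ‖deriv φ a‖ ^ (1 / 8 : ℝ) with hqa
  set QA : ℝ := ∏ i, ‖deriv φ (A i)‖ ^ (1 / 8 : ℝ) with hQA
  have hqa0 : 0 < qa := Real.rpow_pos_of_pos (norm_pos_iff.2 (hder a ha)) _
  have hQA0 : 0 < QA :=
    Finset.prod_pos fun i _ => Real.rpow_pos_of_pos (norm_pos_iff.2 (hder _ (hAΩ i))) _
  have hneg_a : ‖deriv φ a‖ ^ (-(1 / 8 : ℝ)) = qa⁻¹ := Real.rpow_neg (norm_nonneg _) _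
  have hneg_A : (∏ i, ‖deriv φ (A i)‖ ^ (-(1 / 8 : ℝ))) = QA⁻¹ := by
    rw [hQA, ← Finset.prod_inv_distrib]
    exact Finset.prod_congr rfl fun i _ => Real.rpow_neg (norm_nonneg _) _
  set Pcov : ℝ := ‖deriv φ a‖ ^ (-(1 / 8 : ℝ)) * ∏ i, ‖deriv φ (A i)‖ ^ (-(1 / 8 : ℝ)) with hPcov
  have hPcov0 : 0 ≤ Pcov := by rw [hPcov, hneg_a, hneg_A]; positivity
  refine eq_of_forall_pinch fun η hη hη2 => ?_
  -- Lemma 2.26 in both domains, and an auxiliary point `c` near `∂Ω` with `φ c` near `∂Ω'`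
  obtain ⟨ε, hε, hLε⟩ := hL n A hA hAΩ η hη
  obtain ⟨ε', hε', hLε'⟩ := hL' n A' hA' hA'Ω η hη
  obtain ⟨ε₁, hε₁, hbd⟩ := exists_infDist_lt_imp_infDist_image_lt hΩ hΩ' hφ hε'
  obtain ⟨c, hc, hcF, hcε⟩ :=
    exists_mem_notMem_infDist_lt hΩ ((Set.finite_range A).insert a) (lt_min hε hε₁)
  have hca : c ≠ a := fun h => hcF (by rw [h]; exact Set.mem_insert a _)
  have hcA : ∀ i, c ≠ A i := fun i h => hcF (Set.mem_insert_of_mem a ⟨i, h.symm⟩)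
  have hc' : φ c ∈ Ω' := hφ.2.mapsTo hc
  have hcA' : ∀ i, φ c ≠ A' i := fun i h => hcA i (hφ.2.injOn hc (hAΩ i) h)
  have hcε₀ : Metric.infDist c Ωᶜ < ε := hcε.trans_le (min_le_left _ _)
  have hcε' : Metric.infDist (φ c) Ω'ᶜ < ε' := hbd c hc (hcε.trans_le (min_le_right _ _))
  -- the tuples
  have hinj_a : Function.Injective (Matrix.vecCons a A) :=
    Fin.cons_injective_iff.2 ⟨fun ⟨i, hi⟩ => haA i hi.symm, hA⟩
  have hinj_c : Function.Injective (Matrix.vecCons c A) :=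
    Fin.cons_injective_iff.2 ⟨fun ⟨i, hi⟩ => hcA i hi.symm, hA⟩
  have hmem_a : ∀ i, Matrix.vecCons a A i ∈ Ω := fun i => Fin.cases ha hAΩ i
  have hmem_c : ∀ i, Matrix.vecCons c A i ∈ Ω := fun i => Fin.cases hc hAΩ i
  have hinj_a' : Function.Injective (Matrix.vecCons (φ a) A') :=
    Fin.cons_injective_iff.2 ⟨fun ⟨i, hi⟩ => haA' i hi.symm, hA'⟩
  have hinj_c' : Function.Injective (Matrix.vecCons (φ c) A') :=
    Fin.cons_injective_iff.2 ⟨fun ⟨i, hi⟩ => hcA' i hi.symm, hA'⟩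
  have hmem_a' : ∀ i, Matrix.vecCons (φ a) A' i ∈ Ω' := fun i => Fin.cases ha' hA'Ω i
  have hmem_c' : ∀ i, Matrix.vecCons (φ c) A' i ∈ Ω' := fun i => Fin.cases hc' hA'Ω i
  -- Prop 2.20 in both domains, related by Remark 2.21
  obtain ⟨r, hr, hRl⟩ := hP (n + 1) (Matrix.vecCons c A) (Matrix.vecCons a A) hinj_c hinj_a
    hmem_c hmem_a
  obtain ⟨r', hr', hRl'⟩ := hP' (n + 1) (Matrix.vecCons (φ c) A') (Matrix.vecCons (φ a) A')
    hinj_c' hinj_a' hmem_c' hmem_a'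
  have hrr' : r' = r * ((∏ i, ‖deriv φ (Matrix.vecCons c A i)‖ ^ (1 / 8 : ℝ)) /
      ∏ i, ‖deriv φ (Matrix.vecCons a A i)‖ ^ (1 / 8 : ℝ)) := by
    refine hR (n + 1) (Matrix.vecCons c A) (Matrix.vecCons a A) hinj_c hinj_a hmem_c hmem_a r r'
      hRl ?_
    rw [comp_vecCons, comp_vecCons]
    exact hRl'
  -- `T₀` at `c` and `φ c`, related by the one-point covariance
  obtain ⟨G₁, hG₁, hX₁⟩ := h₁ c hc
  obtain ⟨G₁', hG₁', hX₁'⟩ := h₁' (φ c) hc'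
  have h11 : G₁' = ‖deriv φ c‖ ^ (-(1 / 8 : ℝ)) * G₁ := h₁c c hc G₁ G₁' hX₁ hX₁'
  -- the two pinchings
  obtain ⟨hb1, hb2⟩ := le_and_le_of_squeeze hG (tendsto_rhoNormComparison hRl hX₁ hXA)
    (eventually_pinch_rhoNormCorr_cons hM hA hAΩ ha hc haA hcA hG₁ hGA (by linarith) hX₁ hXA
      (hLε c hc hcε₀))
  obtain ⟨hb1', hb2'⟩ := le_and_le_of_squeeze hG' (tendsto_rhoNormComparison hRl' hX₁' hXA')
    (eventually_pinch_rhoNormCorr_cons hM' hA' hA'Ω ha' hc' haA' hcA' hG₁' hGA' (by linarith)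
      hX₁' hXA' (hLε' (φ c) hc' hcε'))
  -- the algebra `ℓ' = Pcov · ℓ`
  set qc : ℝ := ‖deriv φ c‖ ^ (1 / 8 : ℝ) with hqc
  have hqc0 : 0 < qc := Real.rpow_pos_of_pos (norm_pos_iff.2 (hder c hc)) _
  have hneg_c : ‖deriv φ c‖ ^ (-(1 / 8 : ℝ)) = qc⁻¹ := Real.rpow_neg (norm_nonneg _) _
  have hprod_c : (∏ i, ‖deriv φ (Matrix.vecCons c A i)‖ ^ (1 / 8 : ℝ)) = qc * QA := by
    rw [Fin.prod_univ_succ]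
    simp [hqc, hQA]
  have hprod_a : (∏ i, ‖deriv φ (Matrix.vecCons a A i)‖ ^ (1 / 8 : ℝ)) = qa * QA := by
    rw [Fin.prod_univ_succ]
    simp [hqa, hQA]
  have hℓ' : r' * G₁' * GA' = Pcov * (r * G₁ * GA) := by
    rw [hrr', h11, hIHA, hPcov, hprod_c, hprod_a, hneg_c, hneg_a, hneg_A]
    field_simp
  rw [hℓ'] at hb1' hb2'
  have hη1 : (0 : ℝ) < 1 - η := by linarith
  constructor
  · have h3 : (1 - η) * G ≤ r * G₁ * GA := (le_inv_mul_iff₀ hη1).1 hb2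
    calc (1 - η) * (Pcov * G) = Pcov * ((1 - η) * G) := by ring
      _ ≤ Pcov * (r * G₁ * GA) := mul_le_mul_of_nonneg_left h3 hPcov0
      _ ≤ G' := hb1'
  · calc G' ≤ (1 - η)⁻¹ * (Pcov * (r * G₁ * GA)) := hb2'
      _ ≤ (1 - η)⁻¹ * (Pcov * G) :=
        mul_le_mul_of_nonneg_left (mul_le_mul_of_nonneg_left hb1 hPcov0) (inv_nonneg.2 hη1.le)

/-- **CHI Theorem 1.3, covariance rule (1.2) for the limits, from `T₀` (with its covariance),
Proposition 2.20, Remark 2.21 and Lemma 2.26** (the induction of §2.10 run simultaneously in `Ω`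
and `Ω'`): whenever `ϱ^{-n/2} 𝔼⁺_{Ω_δ}[σ_{a₁}⋯σ_{aₙ}] → G` and
`ϱ^{-n/2} 𝔼⁺_{Ω'_δ}[σ_{φa₁}⋯σ_{φaₙ}] → G'` for distinct `aᵢ ∈ Ω` and a conformal bijection
`φ : Ω → Ω'` of admissible domains whose discretisations approximate them, then
`G' = ∏ᵢ |φ'(aᵢ)|^{-1/8} · G`. [cite: ChelkakHonglerIzyurovAnnals2015, Thm. 1.3 eq. (1.2); §2.10 and Remark 2.21] -/
theorem limit_covariance_of_CHI (hΩ : IsAdmissibleDomain Ω) (hM : MeshApproximates Ω)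
    (hΩ' : IsAdmissibleDomain Ω') (hM' : MeshApproximates Ω') (hφ : IsConformalBijection φ Ω Ω')
    (h₁ : CHIOnePointLimits Ω) (hP : CHIRatioLimits Ω) (hL : CHIBoundaryDecorrelation Ω)
    (h₁' : CHIOnePointLimits Ω') (hP' : CHIRatioLimits Ω') (hL' : CHIBoundaryDecorrelation Ω')
    (h₁c : CHIOnePointCovariance Ω Ω' φ) (hR : CHIRatioCovariance Ω Ω' φ) :
    ∀ (n : ℕ) (a : Fin n → ℂ), Function.Injective a → (∀ i, a i ∈ Ω) → ∀ G G' : ℝ,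
      Tendsto (fun δ => rhoNormCorr Ω δ a) (𝓝[>] 0) (𝓝 G) →
      Tendsto (fun δ => rhoNormCorr Ω' δ (fun i => φ (a i))) (𝓝[>] 0) (𝓝 G') →
        G' = (∏ i, ‖deriv φ (a i)‖ ^ (-(1 / 8 : ℝ))) * G := by
  intro n
  induction n with
  | zero =>
    intro a _ _ G G' hG hG'
    have h1 : ∀ (Ω₀ : Set ℂ) (b : Fin 0 → ℂ),
        Tendsto (fun δ => rhoNormCorr Ω₀ δ b) (𝓝[>] 0) (𝓝 1) := by
      intro Ω₀ b
      simp only [rhoNormCorr_def, meshIsingPlusCorr_fin_zero, Nat.cast_zero, neg_zero, zero_div,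
        Real.rpow_zero, mul_one]
      exact tendsto_const_nhds
    rw [tendsto_nhds_unique hG (h1 Ω a), tendsto_nhds_unique hG' (h1 Ω' _)]
    simp
  | succ n ih =>
    intro a ha haΩ G G' hG hG'
    cases n with
    | zero =>
      have hdecomp : a = ![a 0] := by
        ext i
        fin_cases i
        rfl
      have hdecomp' : (fun i => φ (a i)) = ![φ (a 0)] := by
        ext i
        fin_cases i
        rfl
      rw [hdecomp] at hG
      rw [hdecomp'] at hG'
      rw [Fin.prod_univ_one]
      refine h₁c (a 0) (haΩ 0) G G' ?_ ?_
      · simpa [rhoNormCorr_def] using hG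
      · simpa [rhoNormCorr_def] using hG'
    | succ n =>
      have hdecomp : Matrix.vecCons (a 0) (Matrix.vecTail a) = a := Matrix.cons_head_tail a
      have htail : Function.Injective (Matrix.vecTail a) := fun i j h =>
        Fin.succ_injective _ (ha h)
      have htailΩ : ∀ i, Matrix.vecTail a i ∈ Ω := fun i => haΩ i.succ
      have h0 : ∀ i, a 0 ≠ Matrix.vecTail a i := fun i h => Fin.succ_ne_zero i (ha h).symm
      have hG₀ : Tendsto (fun δ => rhoNormCorr Ω δ (Matrix.vecCons (a 0) (Matrix.vecTail a)))
          (𝓝[>] 0) (𝓝 G) := by rwa [hdecomp]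
      have hG₀' : Tendsto (fun δ => rhoNormCorr Ω' δ
          (Matrix.vecCons (φ (a 0)) fun i => φ (Matrix.vecTail a i))) (𝓝[>] 0) (𝓝 G') := by
        rw [← comp_vecCons, hdecomp]
        exact hG'
      have key := limit_covariance_cons hΩ hM hΩ' hM' hφ h₁ hP hL h₁' hP' hL' h₁c hR htail htailΩ
        (ih _ htail htailΩ) (haΩ 0) h0 hG₀ hG₀'
      rw [key]
      congr 1
      conv_rhs => rw [Fin.prod_univ_succ]
      rfl

end Covariance

/-! ### Assembly: `chi_multiPoint_rho` from `chi_onePoint_rho`, Prop 2.20, Remark 2.21, Lemma 2.26 -/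

section Assembly

/-- A conformal bijection of an admissible domain onto `ℍ`: the inverse Cayley transform after the
chosen Riemann map. [cite: Conway1978, Ch. VII Thm. 4.2] -/
theorem IsAdmissibleDomain.exists_isConformalBijection_upperHalfPlane {Ω : Set ℂ}
    (hΩ : IsAdmissibleDomain Ω) :
    ∃ ψ : ℂ → ℂ, IsConformalBijection ψ Ω UpperHalfPlane.upperHalfPlaneSet := by
  obtain ⟨hd, hbij, -, -⟩ := riemannMapBall_spec hΩ
  refine ⟨fun z => RandomPlanarGeometry.cayleyInvFun (riemannMapBall Ω z), ?_, ?_⟩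
  · exact SlitDisc.isConformalBijection_cayleyInvFun.1.comp hd hbij.mapsTo
  · exact SlitDisc.isConformalBijection_cayleyInvFun.2.comp hbij

/-- `T₀` in existence form from the named fact `chi_onePoint_rho`: the limit
`2^{1/4} |ψ'(a)|^{1/8} (2 Im ψ a)^{-1/8}` is positive. [cite: ChelkakHonglerIzyurovAnnals2015, Thm. 1.3 (k = 0)] -/
theorem chiOnePointLimits_of_chi_onePoint_rho (h₀ : chi_onePoint_rho) {Ω : Set ℂ}
    (hΩ : IsAdmissibleDomain Ω) (hM : MeshApproximates Ω) : CHIOnePointLimits Ω := by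
  intro a ha
  obtain ⟨ψ, hψ⟩ := hΩ.exists_isConformalBijection_upperHalfPlane
  refine ⟨onePointPlusCHI ψ a, onePointPlusCHI_pos ?_ (hψ.2.mapsTo ha), h₀ Ω hΩ hM ψ hψ a ha⟩
  exact Literature.Analysis.Complex.SCV.deriv_ne_zero_of_injOn hψ.1 hΩ.1 hψ.2.injOn ha

/-- The one-point covariance from the named fact `chi_onePoint_rho`: with `ψ' : Ω' → ℍ` and
`ψ = ψ' ∘ φ : Ω → ℍ`, the explicit limits `2^{1/4} |ψ'(·)|^{1/8} (2 Im ψ ·)^{-1/8}` at `a` and at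
`φ a` differ by the factor `|φ'(a)|^{1/8}` (chain rule). [cite: ChelkakHonglerIzyurovAnnals2015, Thm. 1.3 (k = 0) with eq. (1.2)] -/
theorem chiOnePointCovariance_of_chi_onePoint_rho (h₀ : chi_onePoint_rho) {Ω Ω' : Set ℂ}
    {φ : ℂ → ℂ} (hΩ : IsAdmissibleDomain Ω) (hM : MeshApproximates Ω)
    (hΩ' : IsAdmissibleDomain Ω') (hM' : MeshApproximates Ω') (hφ : IsConformalBijection φ Ω Ω') :
    CHIOnePointCovariance Ω Ω' φ := by
  intro a ha G G' hG hG'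
  obtain ⟨ψ', hψ'⟩ := hΩ'.exists_isConformalBijection_upperHalfPlane
  -- `ψ = ψ' ∘ φ : Ω → ℍ`
  have hψ : IsConformalBijection (fun z => ψ' (φ z)) Ω UpperHalfPlane.upperHalfPlaneSet :=
    ⟨hψ'.1.comp hφ.1 hφ.2.mapsTo, hψ'.2.comp hφ.2⟩
  have h1 := h₀ Ω hΩ hM _ hψ a ha
  have h2 := h₀ Ω' hΩ' hM' ψ' hψ' (φ a) (hφ.2.mapsTo ha)
  rw [tendsto_nhds_unique hG h1, tendsto_nhds_unique hG' h2]
  -- chain rule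
  have hda : HasDerivAt φ (deriv φ a) a :=
    (hφ.1.differentiableAt (hΩ.1.mem_nhds ha)).hasDerivAt
  have hdψ' : HasDerivAt ψ' (deriv ψ' (φ a)) (φ a) :=
    (hψ'.1.differentiableAt (hΩ'.1.mem_nhds (hφ.2.mapsTo ha))).hasDerivAt
  have hchain : deriv (fun z => ψ' (φ z)) a = deriv ψ' (φ a) * deriv φ a :=
    (hdψ'.comp a hda).deriv
  have hφ' : 0 < ‖deriv φ a‖ := norm_pos_iff.2
    (Literature.Analysis.Complex.SCV.deriv_ne_zero_of_injOn hφ.1 hΩ.1 hφ.2.injOn ha)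
  rw [hchain, norm_mul, Real.mul_rpow (norm_nonneg _) (norm_nonneg _)]
  have hcancel : ‖deriv φ a‖ ^ (-(1 / 8 : ℝ)) * ‖deriv φ a‖ ^ ((1 : ℝ) / 8) = 1 := by
    rw [← Real.rpow_add hφ']; norm_num
  calc (2 : ℝ) ^ ((1 : ℝ) / 4) * ‖deriv ψ' (φ a)‖ ^ ((1 : ℝ) / 8) *
        (2 * (ψ' (φ a)).im) ^ (-(1 : ℝ) / 8)
      = (‖deriv φ a‖ ^ (-(1 / 8 : ℝ)) * ‖deriv φ a‖ ^ ((1 : ℝ) / 8)) *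
          ((2 : ℝ) ^ ((1 : ℝ) / 4) * ‖deriv ψ' (φ a)‖ ^ ((1 : ℝ) / 8) *
            (2 * (ψ' (φ a)).im) ^ (-(1 : ℝ) / 8)) := by rw [hcancel, one_mul]
    _ = ‖deriv φ a‖ ^ (-(1 / 8 : ℝ)) * ((2 : ℝ) ^ ((1 : ℝ) / 4) *
          (‖deriv ψ' (φ a)‖ ^ ((1 : ℝ) / 8) * ‖deriv φ a‖ ^ ((1 : ℝ) / 8)) *
            (2 * (ψ' (φ a)).im) ^ (-(1 : ℝ) / 8)) := by ring

/-- **CHI Theorem 1.3 for all `k` (`chi_multiPoint_rho`) from CHI Theorem 1.3 for `k = 0`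
(`chi_onePoint_rho`), Proposition 2.20, Remark 2.21 and Lemma 2.26** — CHI's own derivation
(§2.10, p. 20), formalised: the existence of the limits is `exists_pos_tendsto_rhoNormCorr`, the
covariance (1.2) of the limit family between approximable admissible domains is
`limit_covariance_of_CHI`, and the packaging into a family covariant between all admissible domains
is the Riemann-map transport `chi_multiPoint_rho_iff`. The three displayed hypotheses are the
published intermediate results of CHI on which the printed proof rests (their own proofs — discrete
spinor observables, CHI §§2.2–2.9 and §3 — are not in the tree); `chi_onePoint_rho` is the tree's
named fact for `k = 0` (itself reduced to CHI Thm 1.1, Prop 2.20 (`k = 0`) and Lemma 2.26 (`k = 1`)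
in `PlanarIsingOnePointProofs.lean`). [cite: ChelkakHonglerIzyurovAnnals2015, Thm. 1.3; §2.10, Prop. 2.20, Remark 2.21, Lemma 2.26] -/
theorem chi_multiPoint_rho_of_CHI (h₀ : chi_onePoint_rho)
    (hP : ∀ Ω : Set ℂ, IsAdmissibleDomain Ω → MeshApproximates Ω → CHIRatioLimits Ω)
    (hL : ∀ Ω : Set ℂ, IsAdmissibleDomain Ω → MeshApproximates Ω → CHIBoundaryDecorrelation Ω)
    (hR : ∀ (Ω Ω' : Set ℂ) (φ : ℂ → ℂ), IsAdmissibleDomain Ω → MeshApproximates Ω →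
      IsAdmissibleDomain Ω' → MeshApproximates Ω' → IsConformalBijection φ Ω Ω' →
        CHIRatioCovariance Ω Ω' φ) :
    chi_multiPoint_rho := by
  have hT : ∀ Ω : Set ℂ, IsAdmissibleDomain Ω → MeshApproximates Ω → ∀ (n : ℕ) (a : Fin n → ℂ),
      Function.Injective a → (∀ i, a i ∈ Ω) → ∃ G : ℝ, 0 < G ∧
        Tendsto (fun δ => rhoCHI δ ^ (-(n : ℝ) / 2) * meshIsingPlusCorr Ω δ a) (𝓝[>] 0) (𝓝 G) :=
    fun Ω hΩ hM n a ha haΩ => exists_pos_tendsto_rhoNormCorr hΩ hM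
      (chiOnePointLimits_of_chi_onePoint_rho h₀ hΩ hM) (hP Ω hΩ hM) (hL Ω hΩ hM) n a ha haΩ
  refine chi_multiPoint_rho_of_tendsto_of_covariantOn
    (fun Ω hΩ hM n a ha haΩ => (hT Ω hΩ hM n a ha haΩ).imp fun G hG => hG.2) ?_
  intro Ω Ω' φ hΩ hM hΩ' hM' hφ n a ha haΩ
  have ha' : Function.Injective fun i => φ (a i) :=
    fun i j hij => ha (hφ.2.injOn (haΩ i) (haΩ j) hij)
  have haΩ' : ∀ i, φ (a i) ∈ Ω' := fun i => hφ.2.mapsTo (haΩ i)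
  obtain ⟨G, -, hG⟩ := hT Ω hΩ hM n a ha haΩ
  obtain ⟨G', -, hG'⟩ := hT Ω' hΩ' hM' n _ ha' haΩ'
  have key := limit_covariance_of_CHI hΩ hM hΩ' hM' hφ
    (chiOnePointLimits_of_chi_onePoint_rho h₀ hΩ hM) (hP Ω hΩ hM) (hL Ω hΩ hM)
    (chiOnePointLimits_of_chi_onePoint_rho h₀ hΩ' hM') (hP Ω' hΩ' hM') (hL Ω' hΩ' hM')
    (chiOnePointCovariance_of_chi_onePoint_rho h₀ hΩ hM hΩ' hM' hφ) (hR Ω Ω' φ hΩ hM hΩ' hM' hφ)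
    n a ha haΩ G G' hG hG'
  have h1 : chiRhoCorr Ω n a = G := hG.limUnder_eq
  have h2 : chiRhoCorr Ω' n (fun i => φ (a i)) = G' := hG'.limUnder_eq
  rw [h1, h2]
  exact key

/-- **CHI Theorem 1.3 for all `k` from CHI's §2 ingredients alone**: combining
`chi_multiPoint_rho_of_CHI` with the `k = 0` step `chi_onePoint_rho_of_CHI` of
`PlanarIsingOnePointProofs.lean` (`T₁ & L₁ ⇒ T₀`), `chi_multiPoint_rho` follows from CHI Thm 1.1
(`+` case, explicit limit (1.2)–(1.3): `hT`), Prop 2.20 (`k = 0` with the explicit one-point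
function: `hP₀`; all `k`, existence of positive ratio limits: `hP`), Lemma 2.26 (`k = 1`: `hL₁`,
the special case `A = ![a]` of `hL`; all `k`: `hL`) and Remark 2.21 (`hR`) — every hypothesis a
binder for a published intermediate result of CHI whose printed proof rests on the discrete
spinor observables of CHI §§2.2–2.9, §3. [cite: ChelkakHonglerIzyurovAnnals2015, Thm. 1.3; Thm. 1.1, Prop. 2.20, Remark 2.21, Lemma 2.26, §2.10] -/
theorem chi_multiPoint_rho_of_CHI_ingredients
    (hT : ∀ (Ω : Set ℂ), IsAdmissibleDomain Ω → MeshApproximates Ω → ∀ (φ : ℂ → ℂ),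
      IsConformalBijection φ Ω UpperHalfPlane.upperHalfPlaneSet → ∀ a ∈ Ω, ∀ c ∈ Ω, c ≠ a →
        Tendsto (fun δ => meshIsingPlusCorr Ω δ ![a, c] / rhoCHI δ) (𝓝[>] 0)
          (𝓝 (twoPointPlusCHI φ a c)))
    (hP₀ : ∀ (Ω : Set ℂ), IsAdmissibleDomain Ω → MeshApproximates Ω → ∀ (φ : ℂ → ℂ),
      IsConformalBijection φ Ω UpperHalfPlane.upperHalfPlaneSet → ∀ a ∈ Ω, ∀ c ∈ Ω,
        Tendsto (fun δ => meshIsingPlusCorr Ω δ ![a] / meshIsingPlusCorr Ω δ ![c]) (𝓝[>] 0)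
          (𝓝 (onePointPlusCHI φ a / onePointPlusCHI φ c)))
    (hL₁ : ∀ (Ω : Set ℂ), IsAdmissibleDomain Ω → MeshApproximates Ω → ∀ a ∈ Ω, ∀ η : ℝ, 0 < η →
      ∃ ε : ℝ, 0 < ε ∧ ∀ c ∈ Ω, Metric.infDist c Ωᶜ < ε →
        ∀ᶠ δ in 𝓝[>] (0 : ℝ), (1 - η) * meshIsingPlusCorr Ω δ ![c, a] ≤
          meshIsingPlusCorr Ω δ ![c] * meshIsingPlusCorr Ω δ ![a])
    (hP : ∀ Ω : Set ℂ, IsAdmissibleDomain Ω → MeshApproximates Ω → CHIRatioLimits Ω)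
    (hL : ∀ Ω : Set ℂ, IsAdmissibleDomain Ω → MeshApproximates Ω → CHIBoundaryDecorrelation Ω)
    (hR : ∀ (Ω Ω' : Set ℂ) (φ : ℂ → ℂ), IsAdmissibleDomain Ω → MeshApproximates Ω →
      IsAdmissibleDomain Ω' → MeshApproximates Ω' → IsConformalBijection φ Ω Ω' →
        CHIRatioCovariance Ω Ω' φ) :
    chi_multiPoint_rho :=
  chi_multiPoint_rho_of_CHI (chi_onePoint_rho_of_CHI hT hP₀ hL₁) hP hL hR

/-- **CHI Theorem 1.3 for all `k` from CHI Theorem 1.1 (both boundary conditions), Prop 2.20,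
Lemma 2.26 and Remark 2.21**: the same assembly with `T₀` supplied by
`chi_onePoint_rho_of_twoPoint` of `PlanarIsingOnePointProofs.lean` (which derives CHI Thm 1.3 for
`k = 0` from the two-point Theorem 1.1 with `+` and free boundary conditions via GHS/GKS, dispensing
with the `k = 0`/`k = 1` cases of Prop 2.20 and Lemma 2.26). All hypotheses are binders for
published results of CHI. [cite: ChelkakHonglerIzyurovAnnals2015, Thm. 1.3; Thm. 1.1, Prop. 2.20, Remark 2.21, Lemma 2.26, §2.10] -/
theorem chi_multiPoint_rho_of_twoPoint_CHI
    (hT : ∀ (Ω : Set ℂ), IsAdmissibleDomain Ω → MeshApproximates Ω → ∀ (φ : ℂ → ℂ),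
      IsConformalBijection φ Ω UpperHalfPlane.upperHalfPlaneSet → ∀ x ∈ Ω, ∀ y ∈ Ω, x ≠ y →
        Tendsto (fun δ => meshIsingPlusCorr Ω δ ![x, y] / rhoCHI δ) (𝓝[>] 0)
          (𝓝 (twoPointPlusCHI φ x y)))
    (hTf : ∀ (Ω : Set ℂ), IsAdmissibleDomain Ω → MeshApproximates Ω → ∀ (φ : ℂ → ℂ),
      IsConformalBijection φ Ω UpperHalfPlane.upperHalfPlaneSet → ∀ x ∈ Ω, ∀ y ∈ Ω, x ≠ y →
        Tendsto (fun δ => meshIsingFreeCorr Ω δ ![x, y] / rhoCHI δ) (𝓝[>] 0)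
          (𝓝 (twoPointFreeCHI φ x y)))
    (hP : ∀ Ω : Set ℂ, IsAdmissibleDomain Ω → MeshApproximates Ω → CHIRatioLimits Ω)
    (hL : ∀ Ω : Set ℂ, IsAdmissibleDomain Ω → MeshApproximates Ω → CHIBoundaryDecorrelation Ω)
    (hR : ∀ (Ω Ω' : Set ℂ) (φ : ℂ → ℂ), IsAdmissibleDomain Ω → MeshApproximates Ω →
      IsAdmissibleDomain Ω' → MeshApproximates Ω' → IsConformalBijection φ Ω Ω' →
        CHIRatioCovariance Ω Ω' φ) :
    chi_multiPoint_rho :=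
  chi_multiPoint_rho_of_CHI (chi_onePoint_rho_of_twoPoint hT hTf) hP hL hR

end Assembly

end Literature.Probability.LatticeModels
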